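import Summits.PneNP.PneNP.Theses.SzkEntropy

/-!
# PneNP / SzkEntropy — the collapse `PhCollapse` (stmt-PneNP-1503)

Route `PneNP/SzkEntropy`, support item stmt-PneNP-1503 (`PhCollapse`, rank 9):

  `Nondeterministic.NP ⊆ Classes.P → PH ⊆ Classes.P`.

The textbook collapse of the polynomial hierarchy under `P = NP`: by induction on `k`,
`Σₖ₊₁ᵖ = ∃ᵖ·co(Σₖᵖ) ⊆ ∃ᵖ·co(P) = ∃ᵖ·P = NP ⊆ P`, using monotonicity of the certificate operator
`polyExists` and of `co`, closure of `P` under complement (`co_P_holds`), and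
`Nondeterministic.NP = polyExists Classes.P` (definitional); then `PH = ⋃ₖ Σₖᵖ ⊆ P`.

References: S. Arora, B. Barak, *Computational Complexity: A Modern Approach* (2009), Thm 5.4
("if P = NP then PH = P"); L. Stockmeyer, *The polynomial-time hierarchy*, TCS 3 (1976), §3.
-/

namespace Summit.PneNP.PneNP.Theorems

open Literature.Computability.Complexity

/-- Every level of the polynomial hierarchy collapses to `P` if `NP ⊆ P`:
`Σₖᵖ ⊆ P` for all `k`, by induction (`Σ₀ᵖ = P`;
`Σₖ₊₁ᵖ = polyExists (co Σₖᵖ) ⊆ polyExists (co P) = polyExists P = NP ⊆ P`).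
[AroraBarakCC2009, Thm 5.4; Stockmeyer1976, §3] -/
theorem SigmaP_subset_P_of_NP_subset_P (hNP : Nondeterministic.NP ⊆ Classes.P) (k : ℕ) :
    SigmaP k ⊆ Classes.P := by
  induction k with
  | zero => exact fun L hL => hL
  | succ k ih =>
    intro L hL
    have hL' : L ∈ polyExists (co (SigmaP k)) := by
      rw [← PiP_eq_co, ← SigmaP_succ]; exact hL
    have hcoP : co Classes.P = Classes.P := co_P_holds
    have hL'' : L ∈ polyExists Classes.P := hcoP ▸ polyExists_mono (co_mono ih) hL'
    exact hNP hL''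

/-- **`PhCollapse` holds** (route SzkEntropy, item stmt-PneNP-1503): `NP ⊆ P → PH ⊆ P`, since
`PH = ⋃ₖ Σₖᵖ` and every `Σₖᵖ ⊆ P` under `NP ⊆ P` (`SigmaP_subset_P_of_NP_subset_P`).
[AroraBarakCC2009, Thm 5.4] -/
theorem szkEntropy_phCollapse_proof :
    Summit.PneNP.PneNP.Theses.SzkEntropy.PhCollapse := by
  unfold Summit.PneNP.PneNP.Theses.SzkEntropy.PhCollapse
  intro hNP L hL
  have hL' : L ∈ ⋃ k, SigmaP k := hL
  obtain ⟨k, hk⟩ := Set.mem_iUnion.1 hL'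
  exact SigmaP_subset_P_of_NP_subset_P hNP k hk

end Summit.PneNP.PneNP.Theorems
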